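import Summits.ResolutionOfSingularities.ResolutionOfSingularities.Theorems.PurelyInseparableDim4NarrowApolarity
import Summits.ResolutionOfSingularities.ResolutionOfSingularities.Theorems.PurelyInseparableDim4NarrowLine
import Summits.ResolutionOfSingularities.ResolutionOfSingularities.Theorems.PurelyInseparableDim4RidgeResidual
import Summits.ResolutionOfSingularities.ResolutionOfSingularities.Theorems.PurelyInseparableDim4DirectrixTwo
import Summits.ResolutionOfSingularities.ResolutionOfSingularities.Theorems.PurelyInseparableDim4WildConesBridge
import Mathlib.LinearAlgebra.FiniteDimensional.Lemmas
import Mathlib.LinearAlgebra.BilinearMap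
import Mathlib.LinearAlgebra.SesquilinearForm.Basic
import Mathlib.LinearAlgebra.Dimension.Constructions
import Mathlib.Algebra.CharP.Two
import HarnessLib
import HarnessLib.Audit.Tags

/-!
# Purely inseparable dim 4 — POLAR PARITY at `p = 2`: `ē` is even, the narrow branch is EMPTY

[OURS · counted 0 · cell `res-dim4-pi`, seat p-7 g2 (brick (ζ) «parity at p = 2», offered 19:38Z);
the census remark «ē = 1 never at p = 2 (alternating polar matrix ⇒ ē ∈ {0, 2, 4})» of crit-2 g2
V-B-34 as a kernel theorem.  Nothing here proves F4-I(2,2) or resolution of singularities in dimension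
≥ 4 / characteristic `p`.]

In characteristic `2` the polar kernel `A(in F)` of a state of order `2` (`PointBlowup.additiveSubspace
= ker polarMap`, the tree's directrix letter `RidgeBudget.ebar F = dim_K A(in F)`) is the radical of the
ALTERNATING pairing `B(v, w) = Σ_{k,i} w_k v_i a_{ki}`, `a_{ki} = coeff_{e_k + e_i} F · ((e_k)_i + 1)`
(zero diagonal: `a_{kk} = 2 · coeff = 0`; symmetric off the diagonal) — p-1 g2's coefficient form
`NarrowApolarity.mem_additiveSubspace_iff_forall` read at `q = 2`.  Hence:

* §1 `even_finrank_sub_finrank_ker_of_isAlt` — SYMPLECTIC REDUCTION, parity form, any field, any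
  finite-dimensional `V`: for an alternating bilinear form `dim V − dim rad(B)` is even (if `B u w = 1`
  then `V = (Ku ⊕ Kw) ⊕ {B u · = B w · = 0}` and the radical lives in the last summand; induction).
* §2 **`even_four_sub_ebar`** / **`ebar_ne_one`** / `ebar_ne_three` — at `p = 2`, `ordZero F = 2`:
  `4 − ē(F)` is even, so `ē(F) ∈ {0, 2, 4}`.
* §3 **`narrowDrop_two : RidgeBudget.NarrowDrop 2 2`** and **`narrowCurvilinear_two :
  RidgeBudget.NarrowCurvilinear 2 2`** hold VACUOUSLY (their hypothesis `ē = 1` is impossible): the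
  NARROW BRANCH of the ridge trichotomy (CARD I-3-9/I-3-10) is EMPTY at `p = 2`.
* §4 **`isolated_chain_ebar_eq_two`** — along every `Step0 2` chain of ISOLATED `2`-fold states in
  characteristic `2`, `ē ≡ 2` from index `1` (sharpens `Directrix.isolated_chain_letter_two`'s
  `{1, 2, 3}`); `noAboveFloorTrap_two : NoAboveFloorTrap 2 2` (isolated band: `ord ≡ 2`) and
  **`noIsolatedTrap_two_two_iff_noWideTrap : NoIsolatedTrap 2 2 ↔ NoWideTrap 2 2`** — F4-I(2,2) IS
  the wide (`e = ē = 2`) cone statement, with no narrow and no above-floor residue; and since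
  F4-I(2,2) is a TREE THEOREM (`WildConesBridge.noIsolatedTrap_two_two`, the Milnor-number route of
  res-hironaka W4.1 bridged by p-12), **`noWideTrap_two : NoWideTrap 2 2`** and
  `ridge_trichotomy_two` — at `p = 2` ALL THREE pieces of the ridge trichotomy are settled.

bears_on: LADDER-RESOLUTION:D157-DOOR2 (res-dim4-pi · F4-I(2,2) · ridge trichotomy at p = 2).
Supports stmt-ResolutionOfSingularities-16155 (helper).
-/

set_option linter.dupNamespace false -- mandated namespace of this single-conjunct summit

noncomputable section

namespace Summit.ResolutionOfSingularities.ResolutionOfSingularities.Theorems.PIDim4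

namespace PolarParity

open MvPolynomial Finset
open Literature.AlgebraicGeometry.Resolution
open Literature.AlgebraicGeometry.Resolution.Hauser2010
open Literature.AlgebraicGeometry.Resolution.HauserPerlega2019
open PointBlowup (additiveSubspace)

/-! ## 1. Symplectic reduction: for an alternating form, `dim V − dim rad` is even -/

section Symplectic

universe u v

variable {L : Type u} [Field L]

/-- **Symplectic reduction, parity form.**  For an ALTERNATING bilinear form `B` on a
finite-dimensional vector space `V` over any field, `dim V − dim rad(B)` is even, `rad(B) = ker B =
{v | B v · = 0}`.  If `B ≠ 0` pick `B u w = 1`; then `z ↦ (B u z, B w z)` is onto `L × L`, its kernel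
`V'` has codimension `2`, and the radical of `B` equals the radical of `B|V'` (decompose
`x = −B(w,x)·u + B(u,x)·w + x'`); induction on `dim V`. [folklore] -/
theorem even_finrank_sub_finrank_ker_of_isAlt :
    ∀ (n : ℕ) {V : Type v} [AddCommGroup V] [Module L V] [FiniteDimensional L V]
      (B : V →ₗ[L] V →ₗ[L] L), B.IsAlt → Module.finrank L V ≤ n →
      Even (Module.finrank L V - Module.finrank L (LinearMap.ker B)) := by
  intro n
  induction n with
  | zero =>
    intro V _ _ _ B hB hn
    rw [Nat.le_zero.mp hn, Nat.zero_sub]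
    exact Even.zero
  | succ n ih =>
    intro V _ _ _ B hB hn
    by_cases h0 : ∀ u w : V, B u w = 0
    · have hker : LinearMap.ker B = ⊤ := by
        rw [eq_top_iff]
        intro u _
        rw [LinearMap.mem_ker]
        ext w
        rw [h0 u w, LinearMap.zero_apply]
      rw [hker, finrank_top, Nat.sub_self]
      exact Even.zero
    · push Not at h0
      obtain ⟨u, w₀, huw₀⟩ := h0
      obtain ⟨w, huw⟩ : ∃ w : V, B u w = 1 :=
        ⟨(B u w₀)⁻¹ • w₀, by rw [map_smul, smul_eq_mul, inv_mul_cancel₀ huw₀]⟩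
      have hwu : B w u = -1 := by rw [← hB.neg u w, huw]
      have huu : B u u = 0 := hB u
      have hww : B w w = 0 := hB w
      -- the projection `z ↦ (B u z, B w z)` onto `L × L`
      obtain ⟨f, hf_apply⟩ : ∃ f : V →ₗ[L] L × L, ∀ z, f z = (B u z, B w z) :=
        ⟨(B u).prod (B w), fun z => rfl⟩
      have hf : LinearMap.range f = ⊤ := by
        rw [eq_top_iff]
        rintro ⟨a, c⟩ -
        refine ⟨a • w - c • u, ?_⟩
        rw [hf_apply]
        simp only [map_sub, map_smul, smul_eq_mul, huw, huu, hww, hwu]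
        ext <;> ring
      obtain ⟨V', hV'def⟩ : ∃ V' : Submodule L V, V' = LinearMap.ker f := ⟨_, rfl⟩
      have hV' : Module.finrank L V' + 2 = Module.finrank L V := by
        have h := LinearMap.finrank_range_add_finrank_ker f
        rw [hf, finrank_top, Module.finrank_prod, Module.finrank_self, ← hV'def] at h
        omega
      have hmemV' : ∀ z : V, z ∈ V' ↔ B u z = 0 ∧ B w z = 0 := fun z => by
        rw [hV'def, LinearMap.mem_ker, hf_apply, Prod.mk_eq_zero]
      -- the restriction of `B` to `V'`
      obtain ⟨B', hB'_apply⟩ :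
          ∃ B' : V' →ₗ[L] V' →ₗ[L] L, ∀ x y : V', B' x y = B (x : V) (y : V) :=
        ⟨B.domRestrict₁₂ V' V', fun x y => rfl⟩
      have hB' : B'.IsAlt := fun x => by rw [hB'_apply]; exact hB (x : V)
      have ih' := ih B' hB' (by omega)
      -- the radical of `B'` is the radical of `B`
      have hker : (LinearMap.ker B').map V'.subtype = LinearMap.ker B := by
        ext z
        rw [Submodule.mem_map, LinearMap.mem_ker]
        constructor
        · rintro ⟨z', hz', rfl⟩
          rw [LinearMap.mem_ker] at hz'
          ext x
          have hx' : x + (B w x) • u - (B u x) • w ∈ V' := by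
            rw [hmemV']
            constructor
            · rw [map_sub, map_add, map_smul, map_smul, huu, huw, smul_eq_mul, smul_eq_mul, mul_zero,
                mul_one, add_zero, sub_self]
            · rw [map_sub, map_add, map_smul, map_smul, hwu, hww, smul_eq_mul, smul_eq_mul, mul_neg,
                mul_one, mul_zero, sub_zero, add_neg_cancel]
          have hz'V := (hmemV' (z' : V)).mp z'.2
          have hzu : B (z' : V) u = 0 := by rw [← hB.neg u, hz'V.1, neg_zero]
          have hzw : B (z' : V) w = 0 := by rw [← hB.neg w, hz'V.2, neg_zero]
          have h1 : B (z' : V) (x + (B w x) • u - (B u x) • w) = 0 := by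
            have := LinearMap.congr_fun hz' ⟨_, hx'⟩
            rw [hB'_apply, LinearMap.zero_apply] at this
            exact this
          rw [map_sub, map_add, map_smul, map_smul, hzu, hzw, smul_zero, smul_zero, add_zero,
            sub_zero] at h1
          rw [Submodule.subtype_apply, h1, LinearMap.zero_apply]
        · intro hz
          have hzV' : z ∈ V' := by
            rw [hmemV']
            constructor
            · rw [← hB.neg z, LinearMap.congr_fun hz u, LinearMap.zero_apply, neg_zero]
            · rw [← hB.neg z, LinearMap.congr_fun hz w, LinearMap.zero_apply, neg_zero]
          refine ⟨⟨z, hzV'⟩, ?_, rfl⟩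
          rw [LinearMap.mem_ker]
          ext x'
          rw [hB'_apply, LinearMap.zero_apply, Submodule.coe_mk, LinearMap.congr_fun hz (x' : V),
            LinearMap.zero_apply]
      have hfin : Module.finrank L (LinearMap.ker B') = Module.finrank L (LinearMap.ker B) := by
        rw [← hker, Submodule.finrank_map_subtype_eq]
      have hle : Module.finrank L (LinearMap.ker B') ≤ Module.finrank L V' :=
        Submodule.finrank_le _
      obtain ⟨m, hm⟩ := ih'
      exact ⟨m + 1, by omega⟩

end Symplectic

/-! ## 2. Characteristic `2`: the polar kernel of a state of order `2` has even dimension -/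

variable {K : Type} [Field K]

/-- Exponents of degree `1` are the `e_k`. [folklore] -/
theorem exists_eq_single_of_degree_eq_one {β : Fin 4 →₀ ℕ} (hβ : β.degree = 1) :
    ∃ k : Fin 4, β = Finsupp.single k 1 := by
  have h : β ∈ {d : Fin 4 →₀ ℕ | d.degree = 1} := hβ
  rw [← Finsupp.range_single_one] at h
  obtain ⟨k, hk⟩ := h
  exact ⟨k, hk.symm⟩

/-- **The polar pairing at `p = 2`.**  For a state of order `2` there is a bilinear form `B` on `K⁴`
whose value is `B v w = Σ_k Σ_i w_k v_i · (coeff_{e_k+e_i} F · ((e_k)_i + 1))` — the coefficient rows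
of `NarrowApolarity.mem_additiveSubspace_iff_forall` at `q = 2` — and whose (left) radical is the
additive subspace `A(in F)`.  No characteristic hypothesis. [folklore] -/
theorem exists_polarPairing {F : MvPolynomial (Fin 4) K} (hord : ordZero F = 2) :
    ∃ B : (Fin 4 → K) →ₗ[K] (Fin 4 → K) →ₗ[K] K,
      (∀ v w : Fin 4 → K, B v w = ∑ k, ∑ i, w k * v i *
        (coeff (Finsupp.single k 1 + Finsupp.single i 1) F *
          (((Finsupp.single k 1 : Fin 4 →₀ ℕ) i : K) + 1))) ∧
      LinearMap.ker B = additiveSubspace (initialForm F) := by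
  refine ⟨LinearMap.mk₂ K (fun v w => ∑ k, ∑ i, w k * v i *
      (coeff (Finsupp.single k 1 + Finsupp.single i 1) F *
        (((Finsupp.single k 1 : Fin 4 →₀ ℕ) i : K) + 1))) ?_ ?_ ?_ ?_, fun v w => rfl, ?_⟩
  · intro v v' w
    rw [← Finset.sum_add_distrib]
    refine Finset.sum_congr rfl fun k _ => ?_
    rw [← Finset.sum_add_distrib]
    refine Finset.sum_congr rfl fun i _ => ?_
    rw [Pi.add_apply]
    ring
  · intro a v w
    simp only [Pi.smul_apply, smul_eq_mul, Finset.mul_sum]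
    refine Finset.sum_congr rfl fun k _ => Finset.sum_congr rfl fun i _ => ?_
    ring
  · intro v w w'
    rw [← Finset.sum_add_distrib]
    refine Finset.sum_congr rfl fun k _ => ?_
    rw [← Finset.sum_add_distrib]
    refine Finset.sum_congr rfl fun i _ => ?_
    rw [Pi.add_apply]
    ring
  · intro a v w
    simp only [Pi.smul_apply, smul_eq_mul, Finset.mul_sum]
    refine Finset.sum_congr rfl fun k _ => Finset.sum_congr rfl fun i _ => ?_
    ring
  · ext v
    rw [LinearMap.mem_ker, NarrowApolarity.mem_additiveSubspace_iff_forall (q := 2) hord]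
    constructor
    · intro hv β hβ
      have hβ1 : β.degree = 1 := by omega
      obtain ⟨k, rfl⟩ := exists_eq_single_of_degree_eq_one hβ1
      have h := LinearMap.congr_fun hv (Pi.single k 1)
      rw [LinearMap.mk₂_apply, LinearMap.zero_apply, Finset.sum_eq_single k] at h
      · rw [← h]
        refine Finset.sum_congr rfl fun i _ => ?_
        rw [Pi.single_eq_same, one_mul]
      · intro k' _ hk'
        refine Finset.sum_eq_zero fun i _ => ?_
        rw [Pi.single_eq_of_ne hk', zero_mul, zero_mul]
      · intro hk
        exact absurd (Finset.mem_univ k) hk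
    · intro hv
      refine LinearMap.ext fun w => ?_
      rw [LinearMap.mk₂_apply, LinearMap.zero_apply]
      refine Finset.sum_eq_zero fun k _ => ?_
      have h := hv (Finsupp.single k 1) (by rw [Finsupp.degree_single])
      have h' : ∑ i, w k * v i * (coeff (Finsupp.single k 1 + Finsupp.single i 1) F *
            (((Finsupp.single k 1 : Fin 4 →₀ ℕ) i : K) + 1)) =
          w k * ∑ i, v i * (coeff (Finsupp.single k 1 + Finsupp.single i 1) F *
            (((Finsupp.single k 1 : Fin 4 →₀ ℕ) i : K) + 1)) := by
        rw [Finset.mul_sum]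
        refine Finset.sum_congr rfl fun i _ => ?_
        ring
      rw [h', h, mul_zero]

/-- The diagonal of the polar coefficient matrix vanishes in characteristic `2`:
`coeff_{2e_k} F · ((e_k)_k + 1) = coeff · 2 = 0`. [folklore] -/
theorem polar_diag_eq_zero [CharP K 2] (F : MvPolynomial (Fin 4) K) (k : Fin 4) :
    coeff (Finsupp.single k 1 + Finsupp.single k 1) F *
      (((Finsupp.single k 1 : Fin 4 →₀ ℕ) k : K) + 1) = 0 := by
  rw [Finsupp.single_eq_same, Nat.cast_one, CharTwo.add_self_eq_zero, mul_zero]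

/-- The polar coefficient matrix is symmetric: for `k ≠ i` both entries are `coeff_{e_k+e_i} F`.
[folklore] -/
theorem polar_symm (F : MvPolynomial (Fin 4) K) (k i : Fin 4) :
    coeff (Finsupp.single k 1 + Finsupp.single i 1) F *
        (((Finsupp.single k 1 : Fin 4 →₀ ℕ) i : K) + 1) =
      coeff (Finsupp.single i 1 + Finsupp.single k 1) F *
        (((Finsupp.single i 1 : Fin 4 →₀ ℕ) k : K) + 1) := by
  by_cases hki : k = i
  · subst hki; rfl
  · rw [add_comm (Finsupp.single k 1), Finsupp.single_eq_of_ne (Ne.symm hki),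
      Finsupp.single_eq_of_ne hki]

/-- **`4 − ē(F)` is even** for a state of order `2` in characteristic `2`: the polar pairing is
ALTERNATING (symmetric with zero diagonal, so the double sum over `(k,i)` cancels in pairs under the
swap), its radical is `A(in F)`, and §1 applies on `K⁴`. [folklore] -/
theorem even_four_sub_ebar [CharP K 2] {F : MvPolynomial (Fin 4) K} (hord : ordZero F = 2) :
    Even (4 - RidgeBudget.ebar F) := by
  classical
  obtain ⟨B, hB, hker⟩ := exists_polarPairing hord
  have halt : B.IsAlt := by
    intro v
    rw [hB, ← Fintype.sum_prod_type']
    refine Finset.sum_ninvolution Prod.swap (fun a => ?_) (fun a ha => ?_) (fun a => Finset.mem_univ _)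
      (fun a => Prod.swap_swap a)
    · -- `f a + f (swap a) = f a + f a = 0`
      have hsw : v a.swap.1 * v a.swap.2 *
          (coeff (Finsupp.single a.swap.1 1 + Finsupp.single a.swap.2 1) F *
            (((Finsupp.single a.swap.1 1 : Fin 4 →₀ ℕ) a.swap.2 : K) + 1)) =
          v a.1 * v a.2 * (coeff (Finsupp.single a.1 1 + Finsupp.single a.2 1) F *
            (((Finsupp.single a.1 1 : Fin 4 →₀ ℕ) a.2 : K) + 1)) := by
        rw [Prod.fst_swap, Prod.snd_swap, polar_symm F a.2 a.1, mul_comm (v a.2) (v a.1)]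
      rw [hsw, CharTwo.add_self_eq_zero]
    · -- a diagonal term is zero
      intro h
      apply ha
      have h1 : a.1 = a.2 := by
        have := congrArg Prod.snd h
        simpa using this
      rw [← h1, polar_diag_eq_zero, mul_zero]
  have h := even_finrank_sub_finrank_ker_of_isAlt (L := K) (Module.finrank K (Fin 4 → K)) B halt le_rfl
  rw [hker, Module.finrank_fin_fun] at h
  exact h

/-- **`ē(F) ≠ 1`** at `p = 2`, `ordZero F = 2`. [folklore] -/
theorem ebar_ne_one [CharP K 2] {F : MvPolynomial (Fin 4) K} (hord : ordZero F = 2) :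
    RidgeBudget.ebar F ≠ 1 := by
  intro h1
  obtain ⟨m, hm⟩ := even_four_sub_ebar hord
  omega

/-- `ē(F) ≠ 3` at `p = 2`, `ordZero F = 2`. [folklore] -/
theorem ebar_ne_three [CharP K 2] {F : MvPolynomial (Fin 4) K} (hord : ordZero F = 2) :
    RidgeBudget.ebar F ≠ 3 := by
  intro h3
  obtain ⟨m, hm⟩ := even_four_sub_ebar hord
  omega

/-- `ē(F) ∈ {0, 2, 4}` at `p = 2`, `ordZero F = 2` (`ē ≤ 4 = dim K⁴`). [folklore] -/
theorem ebar_mem [CharP K 2] {F : MvPolynomial (Fin 4) K} (hord : ordZero F = 2) :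
    RidgeBudget.ebar F = 0 ∨ RidgeBudget.ebar F = 2 ∨ RidgeBudget.ebar F = 4 := by
  have hle : RidgeBudget.ebar F ≤ 4 := by
    have h := Submodule.finrank_le (additiveSubspace (initialForm F))
    rw [Module.finrank_fin_fun] at h
    exact h
  obtain ⟨m, hm⟩ := even_four_sub_ebar hord
  have h1 := ebar_ne_one hord
  have h3 := ebar_ne_three hord
  omega

/-! ## 3. The narrow branch of the ridge trichotomy is EMPTY at `p = 2` -/

/-- **`NarrowDrop 2 2` holds vacuously**: its hypothesis `ē(s.F) = 1` at a state of order `2` is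
impossible in characteristic `2`. [OURS · frame reading] [folklore] -/
theorem narrowDrop_two : RidgeBudget.NarrowDrop 2 2 := by
  intro K _ _ _ s s' N N' _ _ _ hord he _ _
  exact absurd he (ebar_ne_one hord)

/-- **`NarrowCurvilinear 2 2` holds vacuously** (same reason). [OURS · frame reading] [folklore] -/
theorem narrowCurvilinear_two : RidgeBudget.NarrowCurvilinear 2 2 := by
  intro K _ _ _ F N w j hord he _ _ _
  exact absurd he (ebar_ne_one hord)

/-! ## 4. Isolated `(2,2)` chains are wide: `ē ≡ 2` from index `1`; F4-I(2,2) = `NoWideTrap 2 2` -/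

section Chains

variable [DecidableEq K]

/-- **`ē ≡ 2` along isolated `(2,2)` chains** from index `1`: the tree gives `1 ≤ ē ≤ 3` there
(`Directrix.isolated_chain_letter_two`), and parity excludes `1` and `3`.
[OURS · frame reading] [cite: CossartJannsenSaito2020, Thm. 3.10 (4)] -/
theorem isolated_chain_ebar_eq_two [CharP K 2] {c : ℕ → State K}
    (hc : ∀ k, IsIsolated 2 (c k).F ∧ Step0 2 (c k) (c (k + 1))) (k : ℕ) :
    RidgeBudget.ebar (c (k + 1)).F = 2 := by
  obtain ⟨hord, -, -, hbounds⟩ := Directrix.isolated_chain_letter_two hc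
  obtain ⟨h1, h3⟩ := hbounds k
  rcases ebar_mem (hord (k + 1)) with h | h | h
  · rw [RidgeBudget.ebar] at h; omega
  · exact h
  · rw [RidgeBudget.ebar] at h; omega

/-- **`NoAboveFloorTrap 2 2`**: isolated `Step0 2` chains live on the floor `ord₀ = 2`
(`IsolatedBand.isolated_chain_ordZero_eq_two`). [OURS · frame reading] [folklore] -/
theorem noAboveFloorTrap_two : RidgeBudget.NoAboveFloorTrap 2 2 := by
  intro K _ _ _
  rintro ⟨c, hc⟩
  exact (hc 0).2.2 (IsolatedBand.isolated_chain_ordZero_eq_two (fun k => ⟨(hc k).1, (hc k).2.1⟩) 0)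

/-- **F4-I(2,2) is the wide cone statement**: `NoIsolatedTrap 2 2 ↔ NoWideTrap 2 2` (no narrow and no
above-floor residue at `p = 2`). [OURS · glue] [folklore] -/
theorem noIsolatedTrap_two_two_iff_noWideTrap : NoIsolatedTrap 2 2 ↔ RidgeBudget.NoWideTrap 2 2 := by
  haveI : Fact (Nat.Prime 2) := ⟨Nat.prime_two⟩
  rw [RidgeBudget.noIsolatedTrap_iff_residual 2]
  exact ⟨fun h => h.1, fun h => ⟨h, noAboveFloorTrap_two⟩⟩

/-- **Every isolated `(2,2)` chain is, after one shift, a wide cone chain with `ē = 2` EXACTLY**: the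
`p = 2` instance of the `e = ē = 2` regime is the whole of F4-I(2,2). [OURS · frame reading]
[cite: CossartJannsenSaito2020, Def. 3.13 (2) and Thm. 3.10 (4)] -/
theorem isolated_chain_shift_wide [CharP K 2] {c : ℕ → State K}
    (hc : ∀ k, IsIsolated 2 (c k).F ∧ Step0 2 (c k) (c (k + 1))) (k : ℕ) :
    IsIsolated 2 (c (k + 1)).F ∧ Step0 2 (c (k + 1)) (c (k + 1 + 1)) ∧
      ordZero (c (k + 1)).F = 2 ∧ RidgeBudget.ebar (c (k + 1)).F = 2 :=
  ⟨(hc (k + 1)).1, (hc (k + 1)).2,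
    IsolatedBand.isolated_chain_ordZero_eq_two hc (k + 1), isolated_chain_ebar_eq_two hc k⟩

/-- **`NoWideTrap 2 2` holds**: F4-I(2,2) is a tree theorem (`WildConesBridge.noIsolatedTrap_two_two`,
Milnor number strictly decreasing along isolated `Step0 2` chains) and at `p = 2` it IS the wide
statement. [OURS · glue] [cite: GreuelPfister2026, Thm 3.5 and Cor 3.7] -/
theorem noWideTrap_two : RidgeBudget.NoWideTrap 2 2 :=
  noIsolatedTrap_two_two_iff_noWideTrap.mp WildConesBridge.noIsolatedTrap_two_two

/-- **The ridge trichotomy at `p = 2` is settled in all three pieces**: narrow (vacuous, parity),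
wide (Milnor route), above-floor (isolated band). [OURS · glue] [folklore] -/
theorem ridge_trichotomy_two :
    RidgeBudget.NarrowDrop 2 2 ∧ RidgeBudget.NoWideTrap 2 2 ∧ RidgeBudget.NoAboveFloorTrap 2 2 :=
  ⟨narrowDrop_two, noWideTrap_two, noAboveFloorTrap_two⟩

end Chains

end PolarParity

end Summit.ResolutionOfSingularities.ResolutionOfSingularities.Theorems.PIDim4

end
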